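import Literature.Computability.Complexity.ACFourierTails
import Literature.Computability.Complexity.FourierDegree
import Summits.QuantumAdvantage.QuantumAdvantage.Theorems.MobiusLadderLiouvilleOrthogonalTC0SpectralLevel
import Summits.QuantumAdvantage.QuantumAdvantage.Theorems.MobiusLadderLiouvilleOrthogonalTC0StubSwitchRound
import Summits.QuantumAdvantage.QuantumAdvantage.Theorems.MobiusLadderLiouvilleOrthogonalTC0StubThrLeaf
import Summits.QuantumAdvantage.QuantumAdvantage.Theorems.MobiusLadderLiouvilleOrthogonalTC0StubRoundFamily
import Summits.QuantumAdvantage.QuantumAdvantage.Theorems.MobiusLadderLiouvilleOrthogonalTC0StubThrParams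
import Summits.QuantumAdvantage.QuantumAdvantage.Theorems.MobiusLadderLiouvilleOrthogonalTC0StubDrstRecursion
import Summits.QuantumAdvantage.QuantumAdvantage.Theorems.MobiusLadderLiouvilleOrthogonalTC0StubDrstAS
import Summits.QuantumAdvantage.QuantumAdvantage.Theorems.MobiusLadderLiouvilleOrthogonalTC0StubPtfBlock
import Summits.QuantumAdvantage.QuantumAdvantage.Theorems.MobiusLadderLiouvilleOrthogonalTC0StubPtfRung
import Literature.NumberTheory.Sieve.MoebiusWalshCircuitsLiouvilleHolds
import HarnessLib

/-!
# Crux `MobiusLadder.LiouvilleOrthogonalTC0` (stmt-QuantumAdvantage-1393), line `Sketch`, skeleton v11: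
# the threshold-of-`AC⁰` rung (registered stub `stub_thrAC0`, lead glue)

**Theorem (`stub_thrAC0`, unconditional).** For every depth `d`, exponent `A` and `ε > 0`, for all
sufficiently large `n`: for all `K ≤ n^A` circuits `C_a` over `acBasis` (unbounded fan-in `∧/∨/¬`)
with `acDepth ≤ d` and `size ≤ n^A`, all REAL weights `w_a`, thresholds `θ` and signs `b`,
`|Σ_{N<2ⁿ} λ(N) · sgn(b ⊕ [θ ≤ Σ_a w_a C_a(bits N)])| ≤ ε 2ⁿ`.
So `λ` is orthogonal to `MAJ ∘ AC⁰`, `THR ∘ AC⁰` (any weights), every `tcBasis` circuit whose only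
majority gate is its output (`stub_majTop`), every depth-two `MAJ ∘ AND/OR` circuit of unbounded
bottom fan-in, uniformly over the class.

Proof (Gopalan–Servedio 2010-style random restriction, on the tree's PROVED Håstad multi-switching
lemma and Tal round machinery): `ThrAC0.forms_tail_le` — induction on the height of the layered
formulas (`Circuit.exists_acForm`): one switching round per level (`stub_switchRound` with the family of
`swDNF`s of all `nf` subformulas and low members, failure mass by `multiSwitching_count` via
`ThrAC0.bad_le`), at a good leaf the family is rounded one level down (`stub_roundFamily`) and the
induction hypothesis applies; at height `2` the leaf function is a threshold of depth-`ℓ` decision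
trees, a degree-`ℓ` PTF with the uniform DRST tail (`stub_thrLeaf` fed with `ThrAC0.ptf_tail` =
`StubPtfRung.tailWeight_ptf_le` ∘ `stub_ptfBlock` ∘ `stub_drstAS` ∘ `stub_drstRecursion`). Parameters
(`stub_thrParams`): `p = n^{−δ}`, `δ = 1/(2(d+2)R)`, constant partial depth
`ℓ = ⌈2(2A+3)/δ⌉`, level chain `D₀ = ⌊n^{1/R}⌋+1`, `D_{i+1} = ⌊p D_i/4⌋`; conclusion by the level
spectral criterion `liouville_orthogonal_of_tailWeight_level` with Bourgain's `c`
(`bourgain_liouville_walsh_holds`, `R = ⌈3/c⌉`).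
-/

set_option linter.dupNamespace false -- D-0017: single-problem summit ⇒ `QuantumAdvantage.QuantumAdvantage` by design

noncomputable section

namespace Summit.QuantumAdvantage.QuantumAdvantage.Theorems.LiouvilleOrthogonalTC0

open Filter Finset Topology
open Literature.Computability.Complexity
open Literature.Computability.Complexity.LowDegree (tailWeight tailWeight_le_one tailWeight_nonneg)
open Literature.Probability.RandomGraphs.LowDegree (sgn)
open Literature.NumberTheory.Sieve

namespace ThrAC0

/-- **The uniform PTF tail (v10, PROVED):** `W^{≥m}[sgn(b ⊕ [0 ≤ q])] ≤ 6 m^{−1/2^d} + 3/√m` for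
`fourierDegree q ≤ d`, `m ≥ 1` (`StubPtfRung.tailWeight_ptf_le` over `stub_ptfBlock`, `stub_drstAS`,
`stub_drstRecursion`). -/
theorem ptf_tail (n d : ℕ) (q : (Fin n → Bool) → ℝ) (hq : fourierDegree q ≤ d) (b : Bool) (m : ℕ)
    (hm : 1 ≤ m) :
    tailWeight (fun x : Fin n → Bool => sgn (xor b (decide (0 ≤ q x)))) m
      ≤ 6 * (m : ℝ) ^ (-(1 / (2 : ℝ) ^ d)) + 3 / Real.sqrt m :=
  StubPtfRung.tailWeight_ptf_le
    (fun _ _ _ p hp π => stub_ptfBlock (fun m d q hq => stub_drstAS stub_drstRecursion m d q hq) p hp π)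
    q hq b hm

/-! ### Small facts -/

/-- The multi-switching failure mass at threshold `D + 1`, monotone in the number of formulas. -/
theorem bad_le {n m' ℓ : ℕ} (Fam : Fin m' → CNF (Fin n)) (hFv : ∀ i, ∀ C ∈ Fam i, VarNodup C)
    (hFw : ∀ i, ∀ C ∈ Fam i, C.length ≤ ℓ) {p : ℝ} (hp0 : 0 ≤ p) (hp1 : p < 1) (D : ℕ) {M : ℝ}
    (hmM : (m' : ℝ) ≤ M) :
    ∑ ρ ∈ Finset.univ.filter (fun ρ : PAssign n => D + 1 ≤ ccDepth ℓ Fam n ρ), rrWeight p ρ ≤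
      (M + 1) ^ (D / (ℓ + 1) + 1) * (32 * ((ℓ : ℝ) + 1) + 1) ^ (D + 1) * (p / (1 - p)) ^ (D + 1) := by
  have h := multiSwitching_count ℓ Fam ℓ (D + 1) hFv hFw hp0 hp1 (by omega)
  simp only [Nat.add_sub_cancel] at h
  refine h.trans ?_
  have h1p : 0 ≤ p / (1 - p) := div_nonneg hp0 (by linarith)
  have hm0 : (0 : ℝ) ≤ (m' : ℝ) + 1 := by positivity
  have hmono : ((m' : ℝ) + 1) ^ (D / (ℓ + 1) + 1) ≤ (M + 1) ^ (D / (ℓ + 1) + 1) :=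
    pow_le_pow_left₀ hm0 (by linarith) _
  have h32 : (0 : ℝ) ≤ (32 * ((ℓ : ℝ) + 1) + 1) ^ (D + 1) := by positivity
  have hpp : (0 : ℝ) ≤ (p / (1 - p)) ^ (D + 1) := pow_nonneg h1p _
  calc ((m' : ℝ) + 1) ^ (D / (ℓ + 1) + 1) * (32 * ((ℓ : ℝ) + 1) + 1) ^ (D + 1) * (p / (1 - p)) ^ (D + 1)
      ≤ (M + 1) ^ (D / (ℓ + 1) + 1) * (32 * ((ℓ : ℝ) + 1) + 1) ^ (D + 1) * (p / (1 - p)) ^ (D + 1) := by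
        gcongr

/-- The two numerical side conditions of a switching round along the level chain. -/
theorem round_conds {p : ℝ} (hp0 : 0 ≤ p) {k D : ℕ} (hD : D = ⌊p * k / 4⌋₊) (h2 : 2 ≤ D) :
    (8 : ℝ) ≤ p * k ∧ ((2 * D : ℕ) : ℝ) ≤ p * k / 2 := by
  have hx0 : 0 ≤ p * k / 4 := by positivity
  have hDx : (D : ℝ) ≤ p * k / 4 := by rw [hD]; exact Nat.floor_le hx0
  have h2' : (2 : ℝ) ≤ D := by exact_mod_cast h2
  refine ⟨by linarith, ?_⟩
  push_cast
  linarith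

/-- The family of the induction step: all `nf` subformulas of all members, and the members of height
`≤ 2` themselves, enumerated. -/
theorem exists_family {n K : ℕ} (F : Fin K → ACForm n) :
    ∃ (m' : ℕ) (G : Fin m' → ACForm n),
      m' ≤ ∑ a, ((F a).esize + 1) ∧
      (∀ i, (G i).height ≤ 2) ∧
      (∀ i, ∃ a, (G i).width ≤ (F a).width) ∧
      (∀ a, ∀ c ∈ ACForm.subNF (F a), ∃ i, G i = c) ∧
      (∀ a, (F a).height ≤ 2 → ∃ i, G i = F a) := by
  classical
  set S : Finset (ACForm n) := Finset.univ.biUnion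
    (fun a : Fin K => ACForm.subNF (F a) ∪ (if (F a).height ≤ 2 then {F a} else ∅)) with hS
  let e := S.equivFin
  refine ⟨S.card, fun i => (e.symm i).1, ?_, ?_, ?_, ?_, ?_⟩
  · -- size
    refine (Finset.card_biUnion_le).trans (Finset.sum_le_sum fun a _ => ?_)
    refine (Finset.card_union_le _ _).trans (Nat.add_le_add ?_ ?_)
    · exact (Finset.card_le_card (ACForm.subNF_subset_subG (F a))).trans le_rfl
    · split_ifs <;> simp
  · -- heights
    intro i
    show (e.symm i).1.height ≤ 2
    have hi : (e.symm i).1 ∈ S := (e.symm i).2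
    simp only [hS, Finset.mem_biUnion, Finset.mem_univ, true_and, Finset.mem_union] at hi
    obtain ⟨a, hc | hc⟩ := hi
    · obtain ⟨op, cls, hcl⟩ := ACForm.exists_eq_nf_of_mem_subNF hc
      rw [hcl]; simp [ACForm.height]
    · split_ifs at hc with hh
      · rw [Finset.mem_singleton] at hc; rw [hc]; exact hh
      · simp at hc
  · -- widths
    intro i
    show ∃ a, (e.symm i).1.width ≤ (F a).width
    have hi : (e.symm i).1 ∈ S := (e.symm i).2
    simp only [hS, Finset.mem_biUnion, Finset.mem_univ, true_and, Finset.mem_union] at hi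
    obtain ⟨a, hc | hc⟩ := hi
    · exact ⟨a, ACForm.width_le_of_mem_subNF hc⟩
    · split_ifs at hc with hh
      · rw [Finset.mem_singleton] at hc; exact ⟨a, by rw [hc]⟩
      · simp at hc
  · -- the `nf` subformulas are enumerated
    intro a c hc
    have hcS : c ∈ S := by
      simp only [hS, Finset.mem_biUnion, Finset.mem_univ, true_and, Finset.mem_union]
      exact ⟨a, Or.inl hc⟩
    exact ⟨e ⟨c, hcS⟩, by show (e.symm (e ⟨c, hcS⟩)).1 = c; simp⟩
  · -- the low members are enumerated
    intro a ha
    have hcS : F a ∈ S := by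
      simp only [hS, Finset.mem_biUnion, Finset.mem_univ, true_and, Finset.mem_union]
      exact ⟨a, Or.inr (by rw [if_pos ha]; exact Finset.mem_singleton_self _)⟩
    exact ⟨e ⟨F a, hcS⟩, by show (e.symm (e ⟨F a, hcS⟩)).1 = F a; simp⟩

/-! ### The induction on the height -/

/-- **The induction**: along a level chain `D_{i+1} = ⌊p D_i/4⌋` whose terms (up to index `Hc`) are
`≥ 2` and make both the DRST leaf tail and the multi-switching failure mass `≤ η`, every real
threshold of `K` layered formulas of height `≤ h`, width `≤ ℓ` and `Σ (esize + 1) ≤ M` has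
`W^{≥ D_i}[sgn ∘ Φ] ≤ 4^{h-1} η` whenever `i + (h - 1) ≤ Hc`. -/
theorem forms_tail_le {n : ℕ} {ℓ : ℕ} (hℓ : 1 ≤ ℓ)
    {p : ℝ} (hp0 : 0 ≤ p) (hp12 : p ≤ 1 / 2) {M η : ℝ} (hη : 0 ≤ η)
    (Dseq : ℕ → ℕ) (hstep : ∀ i, Dseq (i + 1) = ⌊p * Dseq i / 4⌋₊)
    (Hc : ℕ) (h2 : ∀ j, j ≤ Hc → 2 ≤ Dseq j)
    (hτ : ∀ j, j ≤ Hc → 6 * (Dseq j : ℝ) ^ (-(1 / (2 : ℝ) ^ ℓ)) + 3 / Real.sqrt (Dseq j) ≤ η)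
    (hbad : ∀ j, j ≤ Hc → (M + 1) ^ (Dseq j / (ℓ + 1) + 1) * (32 * ((ℓ : ℝ) + 1) + 1) ^ (Dseq j + 1) *
        (p / (1 - p)) ^ (Dseq j + 1) ≤ η) :
    ∀ h : ℕ, 2 ≤ h → ∀ (K : ℕ) (F : Fin K → ACForm n) (w : Fin K → ℝ) (θ : ℝ) (b : Bool),
      (∀ a, (F a).height ≤ h) → (∀ a, (F a).width ≤ ℓ) → (((∑ a, ((F a).esize + 1) : ℕ) : ℝ) ≤ M) →
      ∀ i, i + (h - 1) ≤ Hc →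
        tailWeight (fun x : Fin n → Bool =>
          sgn (xor b (decide (θ ≤ ∑ a, w a * (if (F a).eval x then (1 : ℝ) else 0))))) (Dseq i)
          ≤ 4 ^ (h - 1) * η := by
  have hp1 : p ≤ 1 := hp12.trans (by norm_num)
  have hp1' : p < 1 := lt_of_le_of_lt hp12 (by norm_num)
  intro h hh
  induction h, hh using Nat.le_induction with
  | base =>
    intro K F w θ b hF hw hM i hi
    have hi1 : i + 1 ≤ Hc := by omega
    obtain ⟨h8, h2D⟩ := round_conds hp0 (hstep i) (h2 (i + 1) hi1)
    set g : (Fin n → Bool) → ℝ := fun x =>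
      sgn (xor b (decide (θ ≤ ∑ a, w a * (if (F a).eval x then (1 : ℝ) else 0)))) with hg
    have hKM : (K : ℝ) ≤ M := by
      refine le_trans ?_ hM
      have : K ≤ ∑ a : Fin K, ((F a).esize + 1) := by
        calc K = ∑ _a : Fin K, 1 := by simp
          _ ≤ ∑ a : Fin K, ((F a).esize + 1) := Finset.sum_le_sum fun a _ => by omega
      exact_mod_cast this
    have hT := stub_switchRound g (fun x => by simp only [hg, sq, Literature.Probability.RandomGraphs.LowDegree.sgn_mul_self]) (fun a => ACForm.swDNF (F a))
      (fun a => ACForm.varNodup_swDNF (F a)) hp0 hp1 h8 h2D hη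
      (fun τ (hτ' : ∀ a, cdt (ACForm.swDNF (F a)) τ ≤ ℓ) => ?_)
    · refine hT.trans ?_
      have hb := bad_le (fun a => ACForm.swDNF (F a)) (fun a => ACForm.varNodup_swDNF (F a))
        (fun a C hC => (ACForm.length_le_width_swDNF (F a) C hC).trans (hw a)) hp0 hp1'
        (Dseq (i + 1)) hKM
      have hB := hbad (i + 1) hi1
      have : (4 : ℝ) ^ (2 - 1) = 4 := by norm_num
      rw [this]
      linarith [hb.trans hB]
    · -- at a leaf every member is a shallow decision tree
      have hDT : ∀ a, ACForm.HasDT τ ℓ (F a) := fun a => ACForm.hasDT_of_cdt_le (hF a) (hτ' a)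
      choose T hTd hTe using hDT
      have hfun : (fun x => g (τ.apply x)) = fun x =>
          sgn (xor b (decide (θ ≤ ∑ a, w a * (if (T a).eval x then (1 : ℝ) else 0)))) := by
        funext x; simp only [hg, hTe]
      rw [hfun]
      have hD1 : 1 ≤ Dseq (i + 1) := by have := h2 (i + 1) hi1; omega
      exact (stub_thrLeaf ptf_tail T hTd w θ b hD1).trans (hτ (i + 1) hi1)
  | succ h hh ih =>
    intro K F w θ b hF hw hM i hi
    have hi1 : i + 1 ≤ Hc := by omega
    obtain ⟨h8, h2D⟩ := round_conds hp0 (hstep i) (h2 (i + 1) hi1)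
    obtain ⟨m', G, hm', hGh, hGw, hGsub, hGlow⟩ := exists_family F
    set g : (Fin n → Bool) → ℝ := fun x =>
      sgn (xor b (decide (θ ≤ ∑ a, w a * (if (F a).eval x then (1 : ℝ) else 0)))) with hg
    have hmM : (m' : ℝ) ≤ M := le_trans (by exact_mod_cast hm') hM
    have hGw' : ∀ j, ∀ C ∈ ACForm.swDNF (G j), C.length ≤ ℓ := by
      intro j C hC
      obtain ⟨a, ha⟩ := hGw j
      exact (ACForm.length_le_width_swDNF (G j) C hC).trans (ha.trans (hw a))
    have hε : (0 : ℝ) ≤ 4 ^ (h - 1) * η := by positivity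
    have hT := stub_switchRound g (fun x => by simp only [hg, sq, Literature.Probability.RandomGraphs.LowDegree.sgn_mul_self]) (fun j => ACForm.swDNF (G j))
      (fun j => ACForm.varNodup_swDNF (G j)) hp0 hp1 h8 h2D hε
      (fun τ (hτ' : ∀ j, cdt (ACForm.swDNF (G j)) τ ≤ ℓ) => ?_)
    · refine hT.trans ?_
      have hb := bad_le (fun j => ACForm.swDNF (G j)) (fun j => ACForm.varNodup_swDNF (G j))
        hGw' hp0 hp1' (Dseq (i + 1)) hmM
      have hB := hbad (i + 1) hi1
      have h4 : (4 : ℝ) ^ (h + 1 - 1) = 4 * 4 ^ (h - 1) := by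
        rw [show h + 1 - 1 = (h - 1) + 1 by omega, pow_succ]; ring
      have h41 : (1 : ℝ) ≤ 4 ^ (h - 1) := one_le_pow₀ (by norm_num)
      rw [h4]
      nlinarith [hb.trans hB]
    · -- at a leaf: the round surgery and the induction hypothesis
      have hgood : ∀ a, ∀ c ∈ ACForm.subNF (F a), ACForm.HasDT τ ℓ c := by
        intro a c hc
        obtain ⟨j, hj⟩ := hGsub a c hc
        have := ACForm.hasDT_of_cdt_le (hGh j) (hτ' j)
        rwa [hj] at this
      have hlow : ∀ a, (F a).height ≤ 2 → ACForm.HasDT τ ℓ (F a) := by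
        intro a ha
        obtain ⟨j, hj⟩ := hGlow a ha
        have := ACForm.hasDT_of_cdt_le (hGh j) (hτ' j)
        rwa [hj] at this
      obtain ⟨F', hF'h, hF'w, hF'e, hF'ev⟩ := stub_roundFamily hℓ le_rfl hh F hF hw τ hgood hlow
      have hfun : (fun x => g (τ.apply x)) = fun x =>
          sgn (xor b (decide (θ ≤ ∑ a, w a * (if (F' a).eval x then (1 : ℝ) else 0)))) := by
        funext x; simp only [hg, hF'ev]
      rw [hfun]
      have hM' : (((∑ a, ((F' a).esize + 1) : ℕ) : ℝ) ≤ M) := by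
        refine le_trans ?_ hM
        exact_mod_cast Finset.sum_le_sum fun a _ => Nat.add_le_add_right (hF'e a) 1
      exact ih K F' w θ b hF'h hF'w hM' (i + 1) (by omega)

/-! ### Parameters and the assembly -/

/-- The DRST leaf rate tends to `0`. -/
theorem tau_tendsto' (ℓ : ℕ) :
    Tendsto (fun m : ℕ => 6 * (m : ℝ) ^ (-(1 / (2 : ℝ) ^ ℓ)) + 3 / Real.sqrt m) atTop (𝓝 0) := by
  have h1 : Tendsto (fun m : ℕ => (m : ℝ) ^ (-(1 / (2 : ℝ) ^ ℓ))) atTop (𝓝 0) :=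
    (tendsto_rpow_neg_atTop (by positivity)).comp tendsto_natCast_atTop_atTop
  have h2 : Tendsto (fun m : ℕ => 3 / Real.sqrt m) atTop (𝓝 0) :=
    tendsto_const_nhds.div_atTop (Real.tendsto_sqrt_atTop.comp tendsto_natCast_atTop_atTop)
  simpa using (h1.const_mul 6).add h2

/-- `Σ_a (esize (F a) + 1) ≤ n^{2A+2}` for `K ≤ n^A` formulas of effective size `≤ 2 n^A`, `n ≥ 2`. -/
theorem sum_esize_le {n K A : ℕ} (hn : 2 ≤ n) (hK : K ≤ n ^ A) (F : Fin K → ACForm n)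
    (hF : ∀ a, (F a).esize ≤ 2 * n ^ A) :
    (((∑ a, ((F a).esize + 1) : ℕ) : ℝ) ≤ (n : ℝ) ^ (2 * A + 2)) := by
  have h1 : ∑ a, ((F a).esize + 1) ≤ K * (2 * n ^ A + 1) := by
    calc ∑ a, ((F a).esize + 1) ≤ ∑ _a : Fin K, (2 * n ^ A + 1) :=
          Finset.sum_le_sum fun a _ => Nat.add_le_add_right (hF a) 1
      _ = K * (2 * n ^ A + 1) := by simp
  have h2 : K * (2 * n ^ A + 1) ≤ n ^ (2 * A + 2) := by
    have hnA : 1 ≤ n ^ A := Nat.one_le_pow _ _ (by omega)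
    calc K * (2 * n ^ A + 1) ≤ n ^ A * (2 * n ^ A + 1) := Nat.mul_le_mul_right _ hK
      _ ≤ n ^ A * (3 * n ^ A) := Nat.mul_le_mul_left _ (by omega)
      _ ≤ n ^ A * (n ^ 2 * n ^ A) := Nat.mul_le_mul_left _ (Nat.mul_le_mul_right _ (by nlinarith))
      _ = n ^ (2 * A + 2) := by ring
  exact_mod_cast h1.trans h2

end ThrAC0

/-- **Registered stub `stub_thrAC0` (v11): the threshold-of-`AC⁰` rung (unconditional).** For every depth `d`, exponent `A` and
`ε > 0`, eventually in `n`: for all `K ≤ n^A` circuits `C_a` over `acBasis` with `acDepth ≤ d` and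
`size ≤ n^A`, all real weights `w`, thresholds `θ` and `b`,
`|Σ_{N<2ⁿ} λ(N) sgn(b ⊕ [θ ≤ Σ_a w_a C_a(bits N)])| ≤ ε 2ⁿ`. -/
theorem stub_thrAC0 (d A : ℕ) :
    ∀ ε : ℝ, 0 < ε → ∀ᶠ n : ℕ in atTop, ∀ (K : ℕ), K ≤ n ^ A →
    ∀ (Cs : Fin K → Circuit (Fin n)),
      (∀ a, (Cs a).IsOver acBasis ∧ (Cs a).acDepth ≤ d ∧ (Cs a).size ≤ n ^ A) →
      ∀ (w : Fin K → ℝ) (θ : ℝ) (b : Bool),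
        |∑ N ∈ Finset.range (2 ^ n), ((ArithmeticFunction.liouville N : ℤ) : ℝ) *
            sgn (xor b (decide (θ ≤ ∑ a, w a *
              (if (Cs a).eval (fun i : Fin n => Nat.testBit N i) then (1 : ℝ) else 0))))|
          ≤ ε * (2 : ℝ) ^ n := by
  intro ε hε
  obtain ⟨c, hc, hBw⟩ := bourgain_liouville_walsh_holds
  -- the level exponent `R`
  set R : ℕ := ⌈(3 : ℝ) / c⌉₊ with hRdef
  have hR1 : 1 ≤ R := by
    have : (0 : ℝ) < 3 / c := by positivity
    exact Nat.one_le_iff_ne_zero.mpr (Nat.pos_iff_ne_zero.mp (Nat.ceil_pos.mpr this))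
  have hRc : 3 ≤ (R : ℝ) * c := by
    have h1 : (3 : ℝ) / c ≤ R := Nat.le_ceil _
    have := mul_le_mul_of_nonneg_right h1 hc.le
    rwa [div_mul_cancel₀ _ hc.ne'] at this
  have hRpos : (0 : ℝ) < R := by exact_mod_cast hR1
  -- the other parameters
  set Hc : ℕ := d + 2 with hHc
  have hHcpos : (0 : ℝ) < Hc := by rw [hHc]; positivity
  set δ : ℝ := 1 / (2 * (Hc : ℝ) * R) with hδdef
  have hδ : 0 < δ := by rw [hδdef]; positivity
  have hδR : δ * Hc * R ≤ 1 / 2 := by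
    rw [hδdef]; field_simp; rfl
  set A' : ℕ := 2 * A + 2 with hA'
  set ℓ : ℕ := ⌈2 * ((A' : ℝ) + 1) / δ⌉₊ with hℓdef
  have hℓge : 2 * ((A' : ℝ) + 1) / δ ≤ ℓ := Nat.le_ceil _
  have hℓ1 : 1 ≤ ℓ := by
    have hδle : δ ≤ 1 := by
      rw [hδdef, div_le_one (by positivity)]
      have h1 : (1 : ℝ) ≤ Hc := by exact_mod_cast (show 1 ≤ Hc by omega)
      have h2 : (1 : ℝ) ≤ R := by exact_mod_cast hR1
      nlinarith
    have : (1 : ℝ) ≤ 2 * ((A' : ℝ) + 1) / δ := by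
      rw [le_div_iff₀ hδ]; nlinarith [(Nat.cast_nonneg A' : (0 : ℝ) ≤ A')]
    exact_mod_cast this.trans hℓge
  have hℓ : ((A' : ℝ) + 1) / (ℓ + 1) ≤ δ / 2 := by
    rw [div_le_div_iff₀ (by positivity) (by norm_num)]
    rw [div_le_iff₀ hδ] at hℓge
    nlinarith
  set η : ℝ := (ε / 3) ^ 2 / 4 ^ (d + 1) with hηdef
  have hη : 0 < η := by rw [hηdef]; positivity
  obtain ⟨Dτ, hDτ⟩ := Filter.eventually_atTop.1 (Filter.Tendsto.eventually_le_const hη (ThrAC0.tau_tendsto' ℓ))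
  set Dmin : ℕ := max 2 (max ⌈4 * ((A' : ℝ) + 2) / δ⌉₊ Dτ) with hDmin
  filter_upwards [stub_thrParams R Hc A' ℓ Dmin hR1 hδ hδR hℓ η hη,
    liouville_orthogonal_of_tailWeight_level hc hBw hR1 hRc ε hε, eventually_ge_atTop 2]
    with n hpar hlevel hn2 K hK Cs hCs w θ b
  obtain ⟨hp12, hbadn, hchain⟩ := hpar
  -- the forms
  have hforms : ∀ a, ∃ f : ACForm n, (∀ x, f.eval x = (Cs a).eval x) ∧ f.height ≤ d + 2 ∧
      f.width ≤ ℓ ∧ f.esize ≤ 2 * n ^ A := by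
    intro a
    obtain ⟨f, hfe, hfh, hfw, hfs⟩ := (Cs a).exists_acForm (hCs a).1
    exact ⟨f, hfe, hfh.trans (by have := (hCs a).2.1; omega), hfw.trans hℓ1,
      hfs.trans (Nat.mul_le_mul_left 2 (hCs a).2.2)⟩
  choose F hFe hFh hFw hFs using hforms
  have hfun : (fun x : Fin n → Bool =>
      sgn (xor b (decide (θ ≤ ∑ a, w a * (if (Cs a).eval x then (1 : ℝ) else 0))))) =
      fun x => sgn (xor b (decide (θ ≤ ∑ a, w a * (if (F a).eval x then (1 : ℝ) else 0)))) := by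
    funext x; simp only [hFe]
  -- the level chain
  set p : ℝ := (n : ℝ) ^ (-δ) with hpdef
  have hp0 : 0 ≤ p := by rw [hpdef]; positivity
  set k0 : ℕ := ⌊(n : ℝ) ^ ((1 : ℝ) / R)⌋₊ + 1 with hk0
  set Dseq : ℕ → ℕ := fun i => (fun D : ℕ => ⌊p * D / 4⌋₊)^[i] k0 with hDseq
  have hstep : ∀ i, Dseq (i + 1) = ⌊p * Dseq i / 4⌋₊ := fun i => by
    simp only [hDseq, Function.iterate_succ_apply']
  have hD0 : Dseq 0 = k0 := by simp only [hDseq, Function.iterate_zero_apply]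
  have hDmin : ∀ j, j ≤ Hc → Dmin ≤ Dseq j := fun j hj => hchain j hj
  have h2 : ∀ j, j ≤ Hc → 2 ≤ Dseq j := fun j hj =>
    le_trans (le_max_left _ _) (hDmin j hj)
  have hτ : ∀ j, j ≤ Hc → 6 * (Dseq j : ℝ) ^ (-(1 / (2 : ℝ) ^ ℓ)) + 3 / Real.sqrt (Dseq j) ≤ η :=
    fun j hj => hDτ _ (le_trans (le_trans (le_max_right _ _) (le_max_right _ _)) (hDmin j hj))
  have hbad : ∀ j, j ≤ Hc → ((n : ℝ) ^ A' + 1) ^ (Dseq j / (ℓ + 1) + 1) *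
      (32 * ((ℓ : ℝ) + 1) + 1) ^ (Dseq j + 1) * (p / (1 - p)) ^ (Dseq j + 1) ≤ η := by
    intro j hj
    refine hbadn (Dseq j) ?_
    have h1 : ⌈4 * ((A' : ℝ) + 2) / δ⌉₊ ≤ Dseq j :=
      le_trans (le_trans (le_max_left _ _) (le_max_right _ _)) (hDmin j hj)
    have h2 : 4 * ((A' : ℝ) + 2) / δ ≤ Dseq j := (Nat.le_ceil _).trans (by exact_mod_cast h1)
    rw [div_le_iff₀ hδ] at h2
    linarith
  have hM := ThrAC0.sum_esize_le hn2 hK F hFs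
  have hmain := ThrAC0.forms_tail_le hℓ1 hp0 hp12 hη.le Dseq hstep Hc h2 hτ hbad (d + 2)
    (by omega) K F w θ b hFh hFw hM 0 (by rw [hHc]; omega)
  rw [hD0] at hmain
  have hfin : (4 : ℝ) ^ (d + 2 - 1) * η = (ε / 3) ^ 2 := by
    rw [show d + 2 - 1 = d + 1 by omega, hηdef]
    field_simp
  rw [hfin, ← hfun] at hmain
  exact hlevel (fun x : Fin n → Bool =>
    xor b (decide (θ ≤ ∑ a, w a * (if (Cs a).eval x then (1 : ℝ) else 0)))) hmain

end Summit.QuantumAdvantage.QuantumAdvantage.Theorems.LiouvilleOrthogonalTC0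

end
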